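import Summits.Ventures.CertifiedManyBodySolver.HubbardAlg.SdaDualEdgeTW
import Literature.MathematicalPhysics.QuantumLattice.FermionGroundStatesMinimiseMeanEnergy
import HarnessLib

/-!
# SDA dual certificates, part 3 — the ENGINE's polar datum built from the Hamiltonian's term structure

HONEST FRAMING: first certified bounds; not a superconductivity verdict; every number certified-of-record or labelled
FLOAT.  SOUNDNESS / ALGEBRA statements only; no number is certified in this module.

Part 2 (`HubbardAlg/SdaDualEdgeTW.lean`) left the two reassembly identities `sumB_eq` / `sumC_eq` of a `TWPolarDatum` as
the certificate's obligations.  Here they are DISCHARGED ONCE AND FOR ALL for the engine's natural datum: the local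
Hamiltonian is the term sum `H_{Λ⁺} = Σ_{X ⊆ Λ⁺} Γ(Φ X)` (`FermionInteraction.localHamiltonian`), so
`[H_{Λ⁺}, Ã] = Σ_X [Γ Φ X, Ã]`, the term of `X` lives on `Λ ∪ X`, and it VANISHES when `X` is disjoint from `Λ` (graded
locality, the Hubbard interaction is even: `FermionInteraction.commute_fermionEmbed_apply_of_disjoint`) or `Φ X = 0`.
Hence for ANY finite family `𝒳` of subsets of `Λ⁺` containing every `X` that meets `Λ` with `Φ X ≠ 0`, and ANY choice of
translates `v X` with `(Λ ∪ X) + v X ⊆ W`, `enginePolarDatum` is a `TWPolarDatum t U W Λ A` — pieces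
`C_X = Γ(Φ X)·Γ(A) − Γ(A)·Γ(Φ X)` and `B_X = Γ(A)ᴴ · C_X` on `Λ ∪ X` — with both identities PROVED.  A relocated EOM
multiplier of an SDA certificate is thereby specified by pure data `(Λ, A, 𝒳, v, δ)`; its membership in the dual cone is
`LTIRectGSDualTW.commutator … (enginePolarDatum …) δ` (part 2), no algebra left to the certificate.  For the Hubbard
interaction the cover is AUTOMATIC: `hubbardTerms Λ` (singletons of `Λ` and the nearest-neighbour bonds through `Λ`) contains
every relevant term (`hubbardTerms_cover`, from `hubbardFermionInteraction_apply_eq_zero`), so `hubbardEngineDatum Λ A v hv`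
and `LTIRectGSDualTW.hubbardCommutator / hubbardStability` take the data `(Λ, A, v, δ | γ)` only.

SCOPE (honest): nearest-neighbour Hubbard `hubbardFermionInteraction 2 t U` (t′ = 0) on `ℤ²`, any rectangle window, any
`(t, U, n)`; the module certifies NO number — a concrete certificate still has to supply its multipliers and ONE
`PosSemidef` claim for the assembled window operator (parts 1–2, `…_of_dualCert[TW]`).

References: [cite: BratteliRobinsonII1997, Prop. 5.3.25; §5.2.2]; [cite: ArakiMoriya2003, §5.1].
-/

noncomputable section

open Matrix Complex Finset
open scoped ComplexOrder MatrixOrder BigOperators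
open Literature.Probability.LatticeModels
open Literature.MathematicalPhysics.QuantumLattice
open Literature.MathematicalPhysics.QuantumLattice.AndersonCluster
open Literature.MathematicalPhysics.QuantumLattice.HubbardWave0
open Literature.MathematicalPhysics.QuantumLattice.ThermodynamicLimit
open Summit.Ventures.CertifiedManyBodySolver.Rows.RectMarginalNodes

namespace Summit.Ventures.CertifiedManyBodySolver.HubbardAlg.SdaDualEdge

section Engine

variable (t U : ℝ) (Λ : Finset (Site 2)) (A : FermionOp Λ)

/-- The COMMUTATOR PIECE of the term `X`: `Γ(Φ X)·Γ(A) − Γ(A)·Γ(Φ X) ∈ 𝔄_{Λ ∪ X}`. -/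
def termComm (X : Finset (Site 2)) : FermionOp (Λ ∪ X) :=
  fermionEmbed (PolySite.incl Finset.subset_union_right) ((hubbardFermionInteraction 2 t U).Φ X) *
      fermionEmbed (PolySite.incl Finset.subset_union_left) A -
    fermionEmbed (PolySite.incl Finset.subset_union_left) A *
      fermionEmbed (PolySite.incl Finset.subset_union_right) ((hubbardFermionInteraction 2 t U).Φ X)

/-- The STABILITY PIECE of the term `X`: `Γ(A)ᴴ · termComm X ∈ 𝔄_{Λ ∪ X}`. -/
def termStab (X : Finset (Site 2)) : FermionOp (Λ ∪ X) :=
  (fermionEmbed (PolySite.incl Finset.subset_union_left) A)ᴴ * termComm t U Λ A X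

/-- The term of `X ⊆ Λ⁺` seen in `𝔄_{Λ⁺}`: `Γ(X ↪ Λ⁺)(Φ X)·Ã − Ã·Γ(X ↪ Λ⁺)(Φ X)`. -/
def termCommUp {X : Finset (Site 2)} (hX : X ⊆ thicken Λ 1) : FermionOp (thicken Λ 1) :=
  fermionEmbed (PolySite.incl hX) ((hubbardFermionInteraction 2 t U).Φ X) *
      fermionEmbed (PolySite.incl (subset_thicken Λ 1)) A -
    fermionEmbed (PolySite.incl (subset_thicken Λ 1)) A *
      fermionEmbed (PolySite.incl hX) ((hubbardFermionInteraction 2 t U).Φ X)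

/-- Embedding the commutator piece of `X ⊆ Λ⁺` into `𝔄_{Λ⁺}` gives the term of `X`. -/
theorem fermionEmbed_termComm {X : Finset (Site 2)} (hX : X ⊆ thicken Λ 1) :
    fermionEmbed (PolySite.incl (Finset.union_subset (subset_thicken Λ 1) hX)) (termComm t U Λ A X) =
      termCommUp t U Λ A hX := by
  unfold termComm termCommUp
  rw [map_sub, map_mul, map_mul, fermionEmbed_fermionEmbed, fermionEmbed_fermionEmbed, PolySite.incl_trans,
    PolySite.incl_trans]

/-- **The local commutator is the sum of its terms**: `[H_{Λ⁺}, Ã] = Σ_{X ⊆ Λ⁺} (Γ Φ X · Ã − Ã · Γ Φ X)`. -/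
theorem commObs_eq_sum_powerset :
    commObs t U Λ A = ∑ X ∈ (thicken Λ 1).powerset,
      if hX : X ⊆ thicken Λ 1 then termCommUp t U Λ A hX else 0 := by
  unfold commObs FermionInteraction.localHamiltonian
  rw [Finset.sum_mul, Finset.mul_sum, ← Finset.sum_sub_distrib, ← Finset.sum_attach ((thicken Λ 1).powerset)]
  refine Finset.sum_congr rfl fun X _ => ?_
  rw [dif_pos (Finset.mem_powerset.1 X.2)]
  rfl

/-- A term of `X` disjoint from `Λ` vanishes (graded locality: the Hubbard interaction is even). -/
theorem termCommUp_eq_zero_of_disjoint {X : Finset (Site 2)} (hX : X ⊆ thicken Λ 1) (hd : Disjoint X Λ) :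
    termCommUp t U Λ A hX = 0 := by
  have hc := FermionInteraction.commute_fermionEmbed_apply_of_disjoint (Ψ := hubbardFermionInteraction 2 t U)
    (hubbardFermionInteraction_isEven t U) hX (subset_thicken Λ 1) hd A
  unfold termCommUp
  rw [hc.eq, sub_self]

/-- A term with `Φ X = 0` vanishes. -/
theorem termCommUp_eq_zero_of_Φ_eq_zero {X : Finset (Site 2)} (hX : X ⊆ thicken Λ 1)
    (h0 : (hubbardFermionInteraction 2 t U).Φ X = 0) : termCommUp t U Λ A hX = 0 := by
  unfold termCommUp
  rw [h0, map_zero, zero_mul, mul_zero, sub_self]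

/-- **Reassembly of the commutator pieces**: for a family `𝒳` of subsets of `Λ⁺` containing every term that meets `Λ`
with `Φ X ≠ 0`, `Σ_{X ∈ 𝒳} Γ(Λ ∪ X ↪ Λ⁺)(termComm X) = [H_{Λ⁺}, Ã]` (indexed by `Fin 𝒳.card` as the data want it). -/
theorem engine_sumC (𝒳 : Finset (Finset (Site 2))) (h𝒳 : ∀ X ∈ 𝒳, X ⊆ thicken Λ 1)
    (hcover : ∀ X, X ⊆ thicken Λ 1 → ¬ Disjoint X Λ → (hubbardFermionInteraction 2 t U).Φ X ≠ 0 → X ∈ 𝒳) :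
    ∑ k : Fin 𝒳.card, fermionEmbed (PolySite.incl (Finset.union_subset (subset_thicken Λ 1)
        (h𝒳 _ (𝒳.equivFin.symm k).2))) (termComm t U Λ A (𝒳.equivFin.symm k).1) = commObs t U Λ A := by
  -- (1) reindex the `Fin 𝒳.card` sum over `↥𝒳` and un-attach, embedding the pieces (`fermionEmbed_termComm`);
  -- (2) extend the sum from `𝒳` to the whole powerset (the missing terms vanish); (3) `commObs_eq_sum_powerset`.
  have step1 : ∑ k : Fin 𝒳.card, fermionEmbed (PolySite.incl (Finset.union_subset (subset_thicken Λ 1)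
      (h𝒳 _ (𝒳.equivFin.symm k).2))) (termComm t U Λ A (𝒳.equivFin.symm k).1) =
      ∑ X ∈ 𝒳, if hX : X ⊆ thicken Λ 1 then termCommUp t U Λ A hX else 0 := by
    rw [← Finset.sum_coe_sort 𝒳]
    refine Fintype.sum_equiv 𝒳.equivFin.symm _ _ fun k => ?_
    rw [dif_pos (h𝒳 _ (𝒳.equivFin.symm k).2), fermionEmbed_termComm]
  rw [step1, commObs_eq_sum_powerset]
  refine Finset.sum_subset (fun X hX => Finset.mem_powerset.2 (h𝒳 X hX)) fun X hXp hXn => ?_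
  rw [dif_pos (Finset.mem_powerset.1 hXp)]
  by_cases hd : Disjoint X Λ
  · exact termCommUp_eq_zero_of_disjoint t U Λ A _ hd
  · by_contra hne
    exact hXn (hcover X (Finset.mem_powerset.1 hXp) hd fun h0 =>
      hne (termCommUp_eq_zero_of_Φ_eq_zero t U Λ A _ h0))

/-- **Reassembly of the stability pieces**: `Σ_{X ∈ 𝒳} Γ(Λ ∪ X ↪ Λ⁺)(termStab X) = Ãᴴ[H_{Λ⁺}, Ã]`. -/
theorem engine_sumB (𝒳 : Finset (Finset (Site 2))) (h𝒳 : ∀ X ∈ 𝒳, X ⊆ thicken Λ 1)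
    (hcover : ∀ X, X ⊆ thicken Λ 1 → ¬ Disjoint X Λ → (hubbardFermionInteraction 2 t U).Φ X ≠ 0 → X ∈ 𝒳) :
    ∑ k : Fin 𝒳.card, fermionEmbed (PolySite.incl (Finset.union_subset (subset_thicken Λ 1)
        (h𝒳 _ (𝒳.equivFin.symm k).2))) (termStab t U Λ A (𝒳.equivFin.symm k).1) = stabilityObs t U Λ A := by
  have h : ∀ k : Fin 𝒳.card, fermionEmbed (PolySite.incl (Finset.union_subset (subset_thicken Λ 1)
      (h𝒳 _ (𝒳.equivFin.symm k).2))) (termStab t U Λ A (𝒳.equivFin.symm k).1) =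
      (fermionEmbed (PolySite.incl (subset_thicken Λ 1)) A)ᴴ * fermionEmbed (PolySite.incl (Finset.union_subset
        (subset_thicken Λ 1) (h𝒳 _ (𝒳.equivFin.symm k).2))) (termComm t U Λ A (𝒳.equivFin.symm k).1) := fun k => by
    unfold termStab
    rw [map_mul, fermionEmbed_conjTranspose, fermionEmbed_fermionEmbed, PolySite.incl_trans]
  rw [Finset.sum_congr rfl fun k _ => h k, ← Finset.mul_sum, engine_sumC t U Λ A 𝒳 h𝒳 hcover, stabilityObs_eq]

variable {W : Finset (Site 2)}

/-- **THE ENGINE'S POLAR DATUM.**  Data: a finite family `𝒳` of subsets of `Λ⁺` containing every `X ⊆ Λ⁺` that meets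
`Λ` with `Φ X ≠ 0` (for the Hubbard interaction: the sites of `Λ` and the nearest-neighbour bonds meeting `Λ`), and
translates `v X` with `(Λ ∪ X) + v X ⊆ W`.  Pieces: `C_X = termComm X`, `B_X = termStab X` on `Λ ∪ X`; BOTH reassembly
identities are PROVED (`engine_sumB`, `engine_sumC`). -/
def enginePolarDatum (𝒳 : Finset (Finset (Site 2))) (h𝒳 : ∀ X ∈ 𝒳, X ⊆ thicken Λ 1)
    (hcover : ∀ X, X ⊆ thicken Λ 1 → ¬ Disjoint X Λ → (hubbardFermionInteraction 2 t U).Φ X ≠ 0 → X ∈ 𝒳)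
    (v : Finset (Site 2) → Site 2) (hv : ∀ X ∈ 𝒳, shiftSet (v X) (Λ ∪ X) ⊆ W) : TWPolarDatum t U W Λ A where
  m := 𝒳.card
  S k := Λ ∪ (𝒳.equivFin.symm k).1
  hS k := Finset.union_subset (subset_thicken Λ 1) (h𝒳 _ (𝒳.equivFin.symm k).2)
  B k := termStab t U Λ A (𝒳.equivFin.symm k).1
  C k := termComm t U Λ A (𝒳.equivFin.symm k).1
  v k := v (𝒳.equivFin.symm k).1
  hv k := hv _ (𝒳.equivFin.symm k).2
  sumB_eq := engine_sumB t U Λ A 𝒳 h𝒳 hcover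
  sumC_eq := engine_sumC t U Λ A 𝒳 h𝒳 hcover

/-- **The engine's relocated EOM multiplier is a dual element** (pure data `(Λ, A, 𝒳, v, δ)`; part 2's
`LTIRectGSDualTW.commutator` with the engine datum). -/
theorem LTIRectGSDualTW.engineCommutator {a b : ℕ} {n : ℝ} (hN : Commute A totalNumber)
    (hS : Commute A HubbardWave0.spinZ) (𝒳 : Finset (Finset (Site 2))) (h𝒳 : ∀ X ∈ 𝒳, X ⊆ thicken Λ 1)
    (hcover : ∀ X, X ⊆ thicken Λ 1 → ¬ Disjoint X Λ → (hubbardFermionInteraction 2 t U).Φ X ≠ 0 → X ∈ 𝒳)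
    (v : Finset (Site 2) → Site 2) (hv : ∀ X ∈ 𝒳, shiftSet (v X) (Λ ∪ X) ⊆ rectWindow a b) (δ : ℂ) :
    LTIRectGSDualTW t U a b n (δ • (enginePolarDatum t U Λ A 𝒳 h𝒳 hcover v hv).commOp) :=
  LTIRectGSDualTW.commutator hN hS _ δ

/-- **The engine's relocated stability multiplier is a dual element** (`γ ≥ 0`). -/
theorem LTIRectGSDualTW.engineStability {a b : ℕ} {n : ℝ} (hN : Commute A totalNumber)
    (hS : Commute A HubbardWave0.spinZ) (𝒳 : Finset (Finset (Site 2))) (h𝒳 : ∀ X ∈ 𝒳, X ⊆ thicken Λ 1)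
    (hcover : ∀ X, X ⊆ thicken Λ 1 → ¬ Disjoint X Λ → (hubbardFermionInteraction 2 t U).Φ X ≠ 0 → X ∈ 𝒳)
    (v : Finset (Site 2) → Site 2) (hv : ∀ X ∈ 𝒳, shiftSet (v X) (Λ ∪ X) ⊆ rectWindow a b) {γ : ℝ} (hγ : 0 ≤ γ) :
    LTIRectGSDualTW t U a b n ((γ : ℂ) • (enginePolarDatum t U Λ A 𝒳 h𝒳 hcover v hv).stabOp) := by
  rw [← TWPolarDatum.twOp_toTWDatum]
  exact LTIRectGSDualTW.stability hN hS _ hγ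

/-! ### The Hubbard term family: the cover is automatic, so an EOM multiplier is the data `(Λ, A, v, δ)` -/

/-- The HUBBARD TERM FAMILY of `Λ`: the singletons `{x}` (`x ∈ Λ`) and the nearest-neighbour bonds `{x, x + e_i}`,
`{x − e_i, x}` through a site `x ∈ Λ` — the only `X` meeting `Λ` with `Φ X ≠ 0`
(`hubbardFermionInteraction_apply_eq_zero`). -/
def hubbardTerms (Λ : Finset (Site 2)) : Finset (Finset (Site 2)) :=
  Λ.image (fun x => ({x} : Finset (Site 2))) ∪
    ((Λ ×ˢ (Finset.univ : Finset (Fin 2))).image (fun p => ({p.1, p.1 + unitVec p.2} : Finset (Site 2))) ∪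
      (Λ ×ˢ (Finset.univ : Finset (Fin 2))).image
        (fun p => ({p.1 - unitVec p.2, p.1 - unitVec p.2 + unitVec p.2} : Finset (Site 2))))

/-- Every Hubbard term of `Λ` lies in `Λ⁺ = thicken Λ 1`. -/
theorem hubbardTerms_subset_thicken (Λ : Finset (Site 2)) : ∀ X ∈ hubbardTerms Λ, X ⊆ thicken Λ 1 := by
  intro X hX
  simp only [hubbardTerms, Finset.mem_union, Finset.mem_image, Finset.mem_product, Finset.mem_univ, and_true]
    at hX
  rcases hX with ⟨x, hx, rfl⟩ | ⟨p, hp, rfl⟩ | ⟨p, hp, rfl⟩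
  · exact Finset.singleton_subset_iff.2 (subset_thicken Λ 1 hx)
  · exact Finset.insert_subset (subset_thicken Λ 1 hp)
      (Finset.singleton_subset_iff.2 (add_unitVec_mem_thicken_one hp p.2))
  · refine Finset.insert_subset (sub_unitVec_mem_thicken_one hp p.2) (Finset.singleton_subset_iff.2 ?_)
    rw [sub_add_cancel]
    exact subset_thicken Λ 1 hp

/-- **The cover property**: a term `X ⊆ Λ⁺` meeting `Λ` with `Φ X ≠ 0` is a Hubbard term of `Λ`. -/
theorem hubbardTerms_cover (Λ : Finset (Site 2)) : ∀ X, X ⊆ thicken Λ 1 → ¬ Disjoint X Λ →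
    (hubbardFermionInteraction 2 t U).Φ X ≠ 0 → X ∈ hubbardTerms Λ := by
  intro X _ hd hΦ
  by_contra hX
  refine hΦ (hubbardFermionInteraction_apply_eq_zero t U (fun x hx => ?_) (fun x i hx => ?_))
  · subst hx
    have hxΛ : x ∈ Λ := by simpa [Finset.disjoint_singleton_left] using hd
    exact hX (Finset.mem_union.2 (Or.inl (Finset.mem_image.2 ⟨x, hxΛ, rfl⟩)))
  · subst hx
    rw [Finset.disjoint_insert_left, Finset.disjoint_singleton_left, not_and_or, not_not, not_not] at hd
    rcases hd with h | h
    · exact hX (Finset.mem_union.2 (Or.inr (Finset.mem_union.2 (Or.inl (Finset.mem_image.2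
        ⟨(x, i), Finset.mem_product.2 ⟨h, Finset.mem_univ _⟩, rfl⟩)))))
    · exact hX (Finset.mem_union.2 (Or.inr (Finset.mem_union.2 (Or.inr (Finset.mem_image.2
        ⟨(x + unitVec i, i), Finset.mem_product.2 ⟨h, Finset.mem_univ _⟩, by
          dsimp only
          rw [add_sub_cancel_right]⟩)))))

/-- **THE HUBBARD ENGINE DATUM**: for any `Λ`, `A ∈ 𝔄_Λ` and translates `v X` relocating `Λ ∪ X` into `W` for each
Hubbard term `X` of `Λ`, a polar datum with both reassembly identities proved. -/
def hubbardEngineDatum (v : Finset (Site 2) → Site 2) (hv : ∀ X ∈ hubbardTerms Λ, shiftSet (v X) (Λ ∪ X) ⊆ W) :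
    TWPolarDatum t U W Λ A :=
  enginePolarDatum t U Λ A (hubbardTerms Λ) (hubbardTerms_subset_thicken Λ) (hubbardTerms_cover t U Λ) v hv

/-- **An SDA relocated EOM multiplier is a dual element — pure data `(Λ, A, v, δ)`**: gauge-invariant `A ∈ 𝔄_Λ`,
translates `v` relocating each `Λ ∪ X` (Hubbard terms `X` of `Λ`) into the window, any `δ ∈ ℂ`. -/
theorem LTIRectGSDualTW.hubbardCommutator {a b : ℕ} {n : ℝ} (hN : Commute A totalNumber)
    (hS : Commute A HubbardWave0.spinZ) (v : Finset (Site 2) → Site 2)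
    (hv : ∀ X ∈ hubbardTerms Λ, shiftSet (v X) (Λ ∪ X) ⊆ rectWindow a b) (δ : ℂ) :
    LTIRectGSDualTW t U a b n (δ • (hubbardEngineDatum t U Λ A v hv).commOp) :=
  LTIRectGSDualTW.commutator hN hS _ δ

/-- The matching relocated stability multiplier (`γ ≥ 0`) — pure data `(Λ, A, v, γ)`. -/
theorem LTIRectGSDualTW.hubbardStability {a b : ℕ} {n : ℝ} (hN : Commute A totalNumber)
    (hS : Commute A HubbardWave0.spinZ) (v : Finset (Site 2) → Site 2)
    (hv : ∀ X ∈ hubbardTerms Λ, shiftSet (v X) (Λ ∪ X) ⊆ rectWindow a b) {γ : ℝ} (hγ : 0 ≤ γ) :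
    LTIRectGSDualTW t U a b n ((γ : ℂ) • (hubbardEngineDatum t U Λ A v hv).stabOp) := by
  rw [← TWPolarDatum.twOp_toTWDatum]
  exact LTIRectGSDualTW.stability hN hS _ hγ

end Engine

end Summit.Ventures.CertifiedManyBodySolver.HubbardAlg.SdaDualEdge

end
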